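import Literature.MathematicalPhysics.QuantumFieldTheory.Balaban1983to89.B4Eq19LatticeInteriorGradient
import Literature.MathematicalPhysics.QuantumFieldTheory.Balaban1983to89.B9Eq343LocalHolderFlat

/-!
# `Balaban1983to89.B9Eq344LocalGradientFlat` — T. Bałaban, *Propagators for lattice gauge theories in a background field*, Commun. Math. Phys. **99** (1985)
# 389–434 [Balaban1985BackgroundPropagators] Thm 3.1 (3.44) p. 398 (*«|(∇_UG′(U)∇\*_Uλ)(x)| ≤ B′₀(ε)(…‖λ‖_ε… + |λ|)»* — ONE derivative on each side, Hölder
# data), with [Balaban1984PropagatorsII] (1.9) p. 226: **THE LOCAL η-SCALE GRADIENT ESTIMATE `Hloc∇` FOR THE FLAT MASSIVE LATTICE EQUATION WITH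
# DIVERGENCE-FORM η-HÖLDER DATA ON THE TORUS — PROVED (exponent `½`)**: for `(Δ^η_1 + 1)z = D^{η*}_1 f` on `TSite d (towerP L m (n+1))`, `‖z‖ ≤ M_z` and
# `‖f(y′,μ) − f(y,μ)‖ ≤ H_f (tdist(y,y′)∕L^{n+1})^{½}` on the `tdist`-ball of radius `4L^{n+1}` about `x`:  `L^{n+1}·‖z(x+e_μ) − z(x)‖ ≤ C∇·(M_z + H_f)` —
# by lifting to the universal cover `ℤ^d` (gen 94's `B9Eq343LocalHolderFlat.exists_covering`), scalarising the fibre, and the interior gradient estimate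
# `B4Eq19LatticeInteriorGradient.exists_interior_gradient_const`.  This is the FLAT CORE of the gradient row of `(Δ^η_U+1)⁻¹D*_U` ∕ `(Δ^η_U+1)⁻¹∇_{U,ν}` on
# Hölder data (print's (3.44) shape) by which STOREY H's covariant Hessian row `H3` is to be docked WITHOUT the Hessian letter (HLb) of
# `B9Eq3152StoreyHOfHLb` — that letter, as typed (Hessian of `G′_k` on ARBITRARY block-localised Hölder data, uniform in `n`), is unsatisfiable for `d ≥ 2`
# (the block term `a′Q̃′†Q̃′` of `Δ′` makes the η-scale mixed second differences of `G′_kλ` grow like `log L^{n+1}` at block edges).  NE9 crux-team LEAF PROVER 01, gen 95.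

statement-level skeleton of published theorems with citation tags; proofs where landed; nothing here is a claim about the Yang–Mills mass gap

CITATION HEADER (lean-in-tree rule).  Audit cell `pub-balaban`, sub-cell `t4`, BINDER row NE9; filed by NE9 crux-team LEAF PROVER 01
(`b2b-balaban-t4-ne9-formalise-leaf-01`, gen 95; bears_on: R4/N22).  Source READ first-hand (`paper:balaban1985-cmp99-background-propagators`, pp. 394–398, 424–426).
The CONTENT is [folklore] (covering map + the discrete Campanato road `B4Eq19Lattice*`); print's (3.44) asserts the estimate WITH a background field and globally with
decay — here the FLAT case, LOCAL form.  REUSED BY NAME: gen 94's `B9Eq343LocalHolderFlat.exists_covering`, `norm_le_of_re_inner_le`,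
`B9Eq323KatoDomination.equiv_covLaplaceSiteK_eq_sum`, `B11Eq103H1Complex.equiv_covDivL2K`; this lineage's `B4Eq19LatticeInteriorGradient.exists_interior_gradient_const`.

WHAT IS PROVED (sorry-free; proof lane — 0 `def`).
* **`gradient_flat_core`** — plain functions on `TSite d P` (`d ≥ 1`, `K ≥ 3`): the flat massive equation `K²Σ_ν(2U − U₋ − U₊) + U = K·∂*F` everywhere, `‖U‖ ≤ M_u`
  on the `tdist`-ball of radius `4K` about `x`, `‖F(y′,μ) − F(y,μ)‖ ≤ H_f √(tdist(y,y′)∕K)` for bond positions in that ball ⟹ `K‖U(x+e_μ) − U(x)‖ ≤ C_d(M_u + H_f)`.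
* `localGradient_flat_P` (the `SiteL2K` currency on a general torus, any scale `K ≥ 1`); **`exists_localGradient_flat`** (`Hloc∇`) — `∃ C∇ ≥ 0` such that for every
  `L ≥ 1`, height `n`, periods `m`, fibre `W`: `(Δ^η_1+1)z = D^{η*}_1 f`, local sup bound `M_z` and local η-`½`-Hölder modulus `H_f` (same direction) on the ball of
  radius `4L^{n+1}` ⟹ `L^{n+1}‖z(shift μ x) − z(x)‖ ≤ C∇(M_z + H_f)` for every `μ`.
HONEST SCOPE.  A FLAT local estimate ([B4] (1.9) ∕ [B9] (3.44) at `A = 0`, local form, `½`-Hölder data) PROVED by a road different from print's; the weighted letter,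
the covariant perturbation (non-divergence split of `Δ_U − Δ_1`), the commutator `[Δ^η_U, ∇_ν]` and the re-docking of `H3` are the successor files; (HLb) as typed is NOT
used and NOT claimed.  NOT summit progress (cell pub-balaban: NE9 NOT PRINTED ∕ NOT PROVED; «NE9 ⇐ the named binders»; row WALLED ON A MODEL (O-NE9-1; #5 UNRULED);
spine PROVED 0∕9; rung (B)+1 finite T⁴ — NOT infinite volume, NOT mass gap, NOT BetaPertH, NOT Clay).  HONEST DEPENDENCY (cell line): continuum YM on T⁴ ⇐ BetaPertH ∧
nine spine estimates (0/9 proved); BetaPertH ⇐ (D1) ∧ (D4) ∧ CAP+tail; G-an2-4 gates asym, D1 and NE2/3/4.  NEW file; nothing modified.  Net new unproved facts: 0.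
-/

noncomputable section

set_option autoImplicit false

open scoped InnerProductSpace ComplexConjugate BigOperators

namespace Literature.MathematicalPhysics.QuantumFieldTheory.Balaban1983to89.B9Eq344LocalGradientFlat

open B4Sect5Torus (TSite tdist tdist_nonneg tdist_symm ccoord)
open B9SectCLatticeCarrier (Bond bpos shift unshift tdist_shift_le)
open B9Eq311L2Pairing (WL2)
open B11Eq103H1Complex (SiteL2K BondL2K covDivL2K covLaplaceSiteK equiv_covDivL2K)
open B9Eq315QTower (towerP towerP_apply)
open B9Eq33CovDerivVector (covDiv_apply)
open B9Eq323KatoDomination (equiv_covLaplaceSiteK_eq_sum)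
open B4Eq19LatticeOperators (Zd unitVec box mem_box box_mono self_mem_box lop dvg fdiff fdiff_apply add_unitVec_mem_box)
open B4Eq19LatticeInteriorGradient (exists_interior_gradient_const)
open B9Eq343LocalHolderFlat (exists_covering norm_le_of_re_inner_le)

variable {d : ℕ}

/-! ## §1 The core estimate for plain functions on the torus -/

/-- **THE LOCAL GRADIENT ESTIMATE FOR THE FLAT MASSIVE LATTICE EQUATION WITH HÖLDER DIVERGENCE-FORM DATA ON A TORUS** (plain functions; `d ≥ 1`; scale
`K ≥ 3`): there is `C_d ≥ 0` such that for all periods `P`, all `U : TSite d P → W`, `F : Bond d P → W` with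
`Σ_ν K²·((U y − U(y−e_ν)) + (U y − U(y+e_ν))) + U y = K·Σ_ν (F(y−e_ν,ν) − F(y,ν))` at every site, `‖U‖ ≤ M_u` on the `tdist`-ball of radius `4K` about `x`,
and `‖F(y′,μ) − F(y,μ)‖ ≤ H_f √(tdist(y,y′)∕K)` whenever `tdist(x,y), tdist(x,y′) ≤ 4K`: for every `μ`, `K·‖U(x+e_μ) − U(x)‖ ≤ C_d (M_u + H_f)`
(lift to `ℤ^d` by `exists_covering`, scalarise, `exists_interior_gradient_const` with data `K⁻¹·re⟪e, F∘π⟫` of modulus `H_f∕K`).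
[folklore] [cite: Balaban1985BackgroundPropagators, Thm 3.1 (3.44) p.398; Balaban1984PropagatorsII, (1.9) p.226] -/
theorem gradient_flat_core (hd : 1 ≤ d) {W : Type*} [NormedAddCommGroup W] [InnerProductSpace ℂ W] : ∃ C : ℝ, 0 ≤ C ∧
    ∀ (P : Fin d → ℕ) [∀ i, NeZero (P i)] (K : ℕ), 3 ≤ K → ∀ (U : TSite d P → W) (F : Bond d P → W) (x : TSite d P) (Mu Hf : ℝ), 0 ≤ Mu → 0 ≤ Hf →
      (∀ y, ∑ ν, ((K : ℝ) ^ 2) • ((U y - U (unshift ν y)) + (U y - U (shift ν y))) + (1 : ℝ) • U y = (K : ℝ) • ∑ ν, (F (unshift ν y, ν) - F (y, ν))) →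
      (∀ y, tdist P x y ≤ 4 * K → ‖U y‖ ≤ Mu) →
      (∀ (y y' : TSite d P) (μ : Fin d), tdist P x y ≤ 4 * K → tdist P x y' ≤ 4 * K → ‖F (y', μ) - F (y, μ)‖ ≤ Hf * Real.sqrt (tdist P y y' / K)) →
      ∀ μ : Fin d, (K : ℝ) * ‖U (shift μ x) - U x‖ ≤ C * (Mu + Hf) := by
  classical
  obtain ⟨C, hC0, hC⟩ := exists_interior_gradient_const d hd
  refine ⟨C, hC0, ?_⟩
  intro P _ K hK U F x Mu Hf hMu hHf hU hbu hbf μ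
  have hP : ∀ i, 1 ≤ P i := fun i => Nat.one_le_iff_ne_zero.2 (NeZero.ne (P i))
  have hK0 : (0 : ℝ) < K := by exact_mod_cast (show 0 < K by omega)
  obtain ⟨π, hπadd, hπsub, hπlip, hπlift⟩ := exists_covering P
  obtain ⟨a, ha, -⟩ := hπlift 0 x
  -- scalarise along a unit vector `e`: `‖v‖ ≤ C'(M_u + H_f)/K` from `re⟪e, v⟫ ≤ C'(M_u + H_f)/K`
  have hgoal : ‖U (shift μ x) - U x‖ ≤ C * (Mu + Hf) / K := by
    apply norm_le_of_re_inner_le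
    intro e he
    set φ : W →L[ℝ] ℝ := Complex.reCLM.comp ((innerSL ℂ e).restrictScalars ℝ) with hφdef
    have hφ : ∀ v : W, φ v = RCLike.re ⟪e, v⟫_ℂ := fun v => rfl
    have hφle : ∀ v : W, |φ v| ≤ ‖v‖ := fun v => by
      rw [hφ]
      calc |RCLike.re ⟪e, v⟫_ℂ| ≤ ‖⟪e, v⟫_ℂ‖ := RCLike.abs_re_le_norm _
        _ ≤ ‖e‖ * ‖v‖ := norm_inner_le_norm _ _
        _ ≤ 1 * ‖v‖ := mul_le_mul_of_nonneg_right he (norm_nonneg _)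
        _ = ‖v‖ := one_mul _
    set uR : Zd d → ℝ := fun y => φ (U (π y)) with huR
    set gR : Zd d → Fin d → ℝ := fun y μ => (K : ℝ)⁻¹ * φ (F (π y, μ)) with hgR
    -- the lattice equation `(−Δ + K⁻²) uR = ∂* gR`
    have hEq : ∀ y ∈ box a (4 * (K : ℤ)), lop (1 / (K : ℝ) ^ 2) uR y = dvg gR y := by
      intro y _
      have h1 := congr_arg φ (hU (π y))
      simp only [map_add, map_sum, map_smul, map_sub, smul_eq_mul] at h1
      rw [B4Eq19LatticeOperators.lop_apply, B4Eq19LatticeOperators.dvg_apply]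
      simp only [huR, hgR, hπadd, hπsub]
      have hK2 : (K : ℝ) ^ 2 ≠ 0 := by positivity
      have h2 : ∑ ν, (2 * φ (U (π y)) - φ (U (shift ν (π y))) - φ (U (unshift ν (π y)))) =
          ((K : ℝ) * ∑ ν, (φ (F (unshift ν (π y), ν)) - φ (F (π y, ν))) - φ (U (π y))) / (K : ℝ) ^ 2 := by
        rw [eq_div_iff hK2, ← h1, one_mul, add_sub_cancel_right, Finset.sum_mul]
        refine Finset.sum_congr rfl fun ν _ => by ring
      rw [h2]
      have e3 : ∑ ν, ((K : ℝ)⁻¹ * φ (F (unshift ν (π y), ν)) - (K : ℝ)⁻¹ * φ (F (π y, ν))) =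
          (K : ℝ)⁻¹ * ∑ ν, (φ (F (unshift ν (π y), ν)) - φ (F (π y, ν))) := by
        rw [Finset.mul_sum]; exact Finset.sum_congr rfl fun _ _ => by ring
      rw [e3]
      field_simp
      ring
    -- the bounds on `Q_{4K}(a)`
    have hdist : ∀ y ∈ box a (4 * (K : ℤ)), tdist P x (π y) ≤ 4 * K := by
      intro y hy
      rw [← ha]
      have := hπlip a y (4 * (K : ℤ)) (by positivity) hy
      push_cast at this; exact this
    have hu' : ∀ y ∈ box a (4 * (K : ℤ)), |uR y| ≤ Mu := fun y hy => (hφle _).trans (hbu _ (hdist y hy))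
    have hg' : ∀ (s : ℕ) (y y' : Zd d), y ∈ box a (4 * (K : ℤ)) → y' ∈ box a (4 * (K : ℤ)) → y' ∈ box y s →
        ∀ ν, |gR y' ν - gR y ν| ≤ Hf / K * Real.sqrt (s / K) := by
      intro s y y' hy hy' hyy' ν
      rw [hgR]; dsimp only
      rw [← mul_sub, abs_mul, abs_of_pos (inv_pos.2 hK0), ← map_sub]
      have h1 : |φ (F (π y', ν) - F (π y, ν))| ≤ Hf * Real.sqrt (tdist P (π y) (π y') / K) :=
        (hφle _).trans (hbf (π y) (π y') ν (hdist y hy) (hdist y' hy'))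
      have h2 : Real.sqrt (tdist P (π y) (π y') / K) ≤ Real.sqrt (s / K) := by
        apply Real.sqrt_le_sqrt
        exact div_le_div_of_nonneg_right (hπlip y y' s (by positivity) hyy') hK0.le
      calc (K : ℝ)⁻¹ * |φ (F (π y', ν) - F (π y, ν))| ≤ (K : ℝ)⁻¹ * (Hf * Real.sqrt (s / K)) :=
            mul_le_mul_of_nonneg_left (h1.trans (mul_le_mul_of_nonneg_left h2 hHf)) (inv_pos.2 hK0).le
        _ = Hf / K * Real.sqrt (s / K) := by rw [div_eq_mul_inv]; ring
    have hmain := (hC K hK uR gR a Mu (Hf / K) hMu (by positivity) hEq hu' hg' μ).1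
    have e1 : C * (Mu / K + Hf / K) = C * (Mu + Hf) / K := by field_simp
    rw [e1] at hmain
    -- `fdiff μ uR a = re⟪e, U(shift μ x) − U x⟫`
    have e2 : fdiff μ uR a = RCLike.re ⟪e, U (shift μ x) - U x⟫_ℂ := by
      rw [fdiff_apply, huR]; dsimp only; rw [hπadd, ha, ← map_sub, hφ]
    rw [← e2]
    exact (le_abs_self _).trans hmain
  rw [le_div_iff₀ hK0] at hgoal
  linarith

/-! ## §2 The `SiteL2K` currency on a general torus -/

/-- **The local gradient estimate on a general torus `TSite d P`, in the `SiteL2K` currency**: from the core constant `C` (hypothesis `hC`, the conclusion of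
`gradient_flat_core`), for every scale `K ≥ 1` (`t = K`), every solution of `(Δ^t_1 + 1)u = D^{t*}_1 f` in `SiteL2K`, a local sup bound `M_u` on `u` and a local
`½`-Hölder modulus `H_f` of `f` (same direction, exponent as a real power) on the `tdist`-ball of radius `4K` about `x`: `K·‖u(x+e_μ) − u(x)‖ ≤ (C + 4)(M_u + H_f)`
(`K ≥ 3`: the core; `K ≤ 2`: the trivial bound `4M_u`). [folklore] [cite: Balaban1985BackgroundPropagators, Thm 3.1 (3.44) p.398; Balaban1984PropagatorsII, (1.9) p.226] -/
theorem localGradient_flat_P {W : Type*} [NormedAddCommGroup W] [InnerProductSpace ℂ W] {C : ℝ} (hC0 : 0 ≤ C)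
    (hC : ∀ (P : Fin d → ℕ) [∀ i, NeZero (P i)] (K : ℕ), 3 ≤ K → ∀ (U : TSite d P → W) (F : Bond d P → W) (x : TSite d P) (Mu Hf : ℝ), 0 ≤ Mu → 0 ≤ Hf →
      (∀ y, ∑ ν, ((K : ℝ) ^ 2) • ((U y - U (unshift ν y)) + (U y - U (shift ν y))) + (1 : ℝ) • U y = (K : ℝ) • ∑ ν, (F (unshift ν y, ν) - F (y, ν))) →
      (∀ y, tdist P x y ≤ 4 * K → ‖U y‖ ≤ Mu) →
      (∀ (y y' : TSite d P) (μ : Fin d), tdist P x y ≤ 4 * K → tdist P x y' ≤ 4 * K → ‖F (y', μ) - F (y, μ)‖ ≤ Hf * Real.sqrt (tdist P y y' / K)) →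
      ∀ μ : Fin d, (K : ℝ) * ‖U (shift μ x) - U x‖ ≤ C * (Mu + Hf))
    (P : Fin d → ℕ) [∀ i, NeZero (P i)] {K : ℕ} (hK1 : 1 ≤ K) {t : ℝ} (ht : t = K) {c₀ : ℝ} [Fact (0 < c₀)]
    (u : SiteL2K ℂ d P c₀ W) (f : BondL2K ℂ d P c₀ W) (x : TSite d P) {Mu Hf : ℝ} (hMu : 0 ≤ Mu) (hHf : 0 ≤ Hf)
    (hu : covLaplaceSiteK ((t : ℝ) : ℂ) (fun _ : Bond d P => (LinearMap.id : W →ₗ[ℂ] W)) (fun _ => LinearMap.id) u + ((1 : ℝ) : ℂ) • u =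
      covDivL2K ℂ c₀ ((t : ℝ) : ℂ) (fun _ : Bond d P => (LinearMap.id : W →ₗ[ℂ] W)) f)
    (hbu : ∀ y, tdist P x y ≤ 4 * (K : ℝ) → ‖WL2.equiv ℂ (fun _ : TSite d P => c₀) W u y‖ ≤ Mu)
    (hbf : ∀ (y y' : TSite d P) (μ : Fin d), tdist P x y ≤ 4 * (K : ℝ) → tdist P x y' ≤ 4 * (K : ℝ) →
      ‖WL2.equiv ℂ (fun _ : Bond d P => c₀) W f (y', μ) - WL2.equiv ℂ (fun _ : Bond d P => c₀) W f (y, μ)‖ ≤ Hf * (tdist P y y' / (K : ℝ)) ^ ((1 : ℝ) / 2))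
    (μ : Fin d) :
    (K : ℝ) * ‖WL2.equiv ℂ (fun _ : TSite d P => c₀) W u (shift μ x) - WL2.equiv ℂ (fun _ : TSite d P => c₀) W u x‖ ≤ (C + 4) * (Mu + Hf) := by
  classical
  have hP : ∀ i, 1 ≤ P i := fun i => Nat.one_le_iff_ne_zero.2 (NeZero.ne (P i))
  have hK0 : (0 : ℝ) < K := by exact_mod_cast hK1
  -- the pointwise equation with real scalars `K²`, `1`, `K`
  have hpt : ∀ y : TSite d P, ∑ ν, ((K : ℝ) ^ 2) • ((WL2.equiv ℂ (fun _ : TSite d P => c₀) W u y - WL2.equiv ℂ (fun _ : TSite d P => c₀) W u (unshift ν y)) +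
        (WL2.equiv ℂ (fun _ : TSite d P => c₀) W u y - WL2.equiv ℂ (fun _ : TSite d P => c₀) W u (shift ν y))) +
        (1 : ℝ) • WL2.equiv ℂ (fun _ : TSite d P => c₀) W u y =
      (K : ℝ) • ∑ ν, (WL2.equiv ℂ (fun _ : Bond d P => c₀) W f (unshift ν y, ν) - WL2.equiv ℂ (fun _ : Bond d P => c₀) W f (y, ν)) := by
    intro y
    have e := congr_arg (fun g => WL2.equiv ℂ _ W g y) hu
    simp only [WL2.equiv_add, WL2.equiv_smul, Pi.add_apply, Pi.smul_apply] at e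
    have hs := equiv_covLaplaceSiteK_eq_sum (𝕜 := ℂ) (c₀ := c₀) t (fun _ : Bond d P => (LinearMap.id : W →ₗ[ℂ] W)) (fun _ => LinearMap.id)
      (fun b w => rfl) u y
    rw [RCLike.ofReal_eq_complex_ofReal] at hs
    rw [hs, equiv_covDivL2K, covDiv_apply] at e
    simp only [LinearMap.id_coe, id_eq, Complex.coe_smul] at e
    rw [ht] at e
    exact e
  -- the Hölder hypothesis with `Real.sqrt`
  have hbf' : ∀ (y y' : TSite d P) (μ : Fin d), tdist P x y ≤ 4 * (K : ℝ) → tdist P x y' ≤ 4 * (K : ℝ) →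
      ‖WL2.equiv ℂ (fun _ : Bond d P => c₀) W f (y', μ) - WL2.equiv ℂ (fun _ : Bond d P => c₀) W f (y, μ)‖ ≤ Hf * Real.sqrt (tdist P y y' / K) := by
    intro y y' ν h1 h2
    rw [Real.sqrt_eq_rpow]; exact hbf y y' ν h1 h2
  have hRHS0 : 0 ≤ (C + 4) * (Mu + Hf) := by positivity
  by_cases hK3 : 3 ≤ K
  · -- the main case
    have hmain := hC P K hK3 _ _ x Mu Hf hMu hHf hpt hbu hbf' μ
    refine hmain.trans ?_
    nlinarith
  · -- small scale `K ≤ 2`: the trivial bound `4 M_u`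
    have hK2 : (K : ℝ) ≤ 2 := by exact_mod_cast (show K ≤ 2 by omega)
    have hx : tdist P x x ≤ 4 * K := by rw [B4Sect5Torus.tdist_self]; positivity
    have hK1R : (1 : ℝ) ≤ K := by exact_mod_cast hK1
    have hx' : tdist P x (shift μ x) ≤ 4 * K := (tdist_shift_le hP μ x).trans (by linarith)
    have h1 : ‖WL2.equiv ℂ (fun _ : TSite d P => c₀) W u (shift μ x) - WL2.equiv ℂ (fun _ : TSite d P => c₀) W u x‖ ≤ 2 * Mu := by
      calc ‖WL2.equiv ℂ (fun _ : TSite d P => c₀) W u (shift μ x) - WL2.equiv ℂ (fun _ : TSite d P => c₀) W u x‖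
          ≤ ‖WL2.equiv ℂ (fun _ : TSite d P => c₀) W u (shift μ x)‖ + ‖WL2.equiv ℂ (fun _ : TSite d P => c₀) W u x‖ := norm_sub_le _ _
        _ ≤ Mu + Mu := add_le_add (hbu _ hx') (hbu x hx)
        _ = 2 * Mu := by ring
    have h0 : 0 ≤ ‖WL2.equiv ℂ (fun _ : TSite d P => c₀) W u (shift μ x) - WL2.equiv ℂ (fun _ : TSite d P => c₀) W u x‖ := norm_nonneg _
    calc (K : ℝ) * ‖WL2.equiv ℂ (fun _ : TSite d P => c₀) W u (shift μ x) - WL2.equiv ℂ (fun _ : TSite d P => c₀) W u x‖ ≤ 2 * (2 * Mu) :=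
          mul_le_mul hK2 h1 h0 (by norm_num)
      _ ≤ (C + 4) * (Mu + Hf) := by nlinarith

/-! ## §3 `Hloc∇` on the model's tori -/

/-- **`Hloc∇` HOLDS (exponent ½)**: there is `C∇ ≥ 0` (depending only on `d`) such that for every `L ≥ 1`, height `n`, `η = L^{−(n+1)}`, weight `c₀`, periods `m`, fibre
`W`, every solution `z` of the FLAT massive lattice equation `(Δ^η_1 + 1)z = D^{η*}_1 f` on `TSite d (towerP L m (n+1))`, every centre `x`, a local bound `‖z‖ ≤ M_z`
on the `tdist`-ball of radius `4L^{n+1}` about `x`, and a local η-scale `½`-Hölder modulus of the bond data in that ball,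
`‖f(y′,μ) − f(y,μ)‖ ≤ H_f (tdist(y,y′)∕L^{n+1})^{½}`: for every direction `μ`, `L^{n+1}·‖z(x+e_μ) − z(x)‖ ≤ C∇ (M_z + H_f)` — the η-scale GRADIENT of `z` at `x` is
bounded by the local sup of `z` and the local Hölder constant of `f` (`localGradient_flat_P`; `d = 0` is trivial).  This is the flat, local form of print's (3.44)
`|∇G′∇*λ| ≤ B′₀(ε)(‖λ‖_ε + |λ|)`. [folklore] [cite: Balaban1985BackgroundPropagators, Thm 3.1 (3.44) p.398; Balaban1984PropagatorsII, (1.9) p.226] -/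
theorem exists_localGradient_flat (L : ℕ) [NeZero L] {W : Type*} [NormedAddCommGroup W] [InnerProductSpace ℂ W] :
    ∃ Cg : ℝ, 0 ≤ Cg ∧
    ∀ (n : ℕ) (η : ℝ), η * (L : ℝ) ^ (n + 1) = 1 → ∀ (c₀ : ℝ) [Fact (0 < c₀)] (m : Fin d → ℕ) [∀ i, NeZero (m i)]
      (z : SiteL2K ℂ d (towerP L m (n + 1)) c₀ W) (f : BondL2K ℂ d (towerP L m (n + 1)) c₀ W) (x : TSite d (towerP L m (n + 1))) (Mz Hf : ℝ), 0 ≤ Mz → 0 ≤ Hf →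
      covLaplaceSiteK ((η⁻¹ : ℝ) : ℂ) (fun _ : Bond d (towerP L m (n + 1)) => (LinearMap.id : W →ₗ[ℂ] W)) (fun _ => LinearMap.id) z + ((1 : ℝ) : ℂ) • z =
        covDivL2K ℂ c₀ ((η⁻¹ : ℝ) : ℂ) (fun _ : Bond d (towerP L m (n + 1)) => (LinearMap.id : W →ₗ[ℂ] W)) f →
      (∀ y, tdist (towerP L m (n + 1)) x y ≤ 4 * (L : ℝ) ^ (n + 1) → ‖WL2.equiv ℂ (fun _ : TSite d (towerP L m (n + 1)) => c₀) W z y‖ ≤ Mz) →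
      (∀ (y y' : TSite d (towerP L m (n + 1))) (μ : Fin d), tdist (towerP L m (n + 1)) x y ≤ 4 * (L : ℝ) ^ (n + 1) →
        tdist (towerP L m (n + 1)) x y' ≤ 4 * (L : ℝ) ^ (n + 1) →
        ‖WL2.equiv ℂ (fun _ : Bond d (towerP L m (n + 1)) => c₀) W f (y', μ) - WL2.equiv ℂ (fun _ : Bond d (towerP L m (n + 1)) => c₀) W f (y, μ)‖ ≤
          Hf * (tdist (towerP L m (n + 1)) y y' / (L : ℝ) ^ (n + 1)) ^ ((1 : ℝ) / 2)) →
      ∀ μ : Fin d, (L : ℝ) ^ (n + 1) * ‖WL2.equiv ℂ (fun _ : TSite d (towerP L m (n + 1)) => c₀) W z (shift μ x) -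
          WL2.equiv ℂ (fun _ : TSite d (towerP L m (n + 1)) => c₀) W z x‖ ≤ Cg * (Mz + Hf) := by
  classical
  by_cases hd : 1 ≤ d
  swap
  · -- `d = 0`: no directions
    have hd0 : d = 0 := by omega
    subst hd0
    refine ⟨0, le_rfl, ?_⟩
    intro n η hηL c₀ _ m _ z f x Mz Hf hMz hHf hz hbz hbf μ
    exact Fin.elim0 μ
  obtain ⟨C, hC0, hC⟩ := gradient_flat_core hd (W := W)
  refine ⟨C + 4, by positivity, ?_⟩
  intro n η hηL c₀ _ m _ z f x Mz Hf hMz hHf hz hbz hbf μ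
  haveI : ∀ i, NeZero (towerP L m (n + 1) i) := fun i => ⟨by
    rw [towerP_apply]; exact Nat.mul_ne_zero (pow_ne_zero _ (NeZero.ne L)) (NeZero.ne (m i))⟩
  have hLK : (L : ℝ) ^ (n + 1) = ((L ^ (n + 1) : ℕ) : ℝ) := by push_cast; ring
  have hK1 : 1 ≤ L ^ (n + 1) := Nat.one_le_iff_ne_zero.2 (pow_ne_zero _ (NeZero.ne L))
  have hηK : η⁻¹ = ((L ^ (n + 1) : ℕ) : ℝ) := by rw [← hLK]; exact inv_eq_of_mul_eq_one_right hηL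
  rw [hLK] at hbz hbf ⊢
  exact localGradient_flat_P hC0 hC (towerP L m (n + 1)) hK1 hηK z f x hMz hHf hz hbz hbf μ

end Literature.MathematicalPhysics.QuantumFieldTheory.Balaban1983to89.B9Eq344LocalGradientFlat

end
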